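import Literature.NumberTheory.Automorphic.OrdinaryCompletedCohomologyGL
import Literature.NumberTheory.Automorphic.HidaTowerCentralHecke
import Literature.NumberTheory.Automorphic.TameLevelScalarFactorisation
import HarnessLib

/-!
# The centre of the diamond character in terms of the `T_{w,n}⁻¹`

From the factorisation `u · 1 = D · C · y` of a principal adelic scalar (`globalEmbedding_scalar_eq`,
`scalarRemainder_mem_hidaLevel`), the triviality of `T_{u·1}` on the Hida tower
(`hidaFamily_globalEmbedding_scalar`: global central elements act trivially on `H^•(GL_n(K), ·)`)
and the multiplicativity of the Hecke operators of normalising elements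
(`hidaFamily_mul_of_conj`), we get in the Hida Hecke algebra `𝕋^S(𝒰; p)`

  `∏_{v ∣ p} ⟨(û_v, …, û_v)⟩_v = ∏_{w ∣ u, w ∉ S} (T_{w,n}⁻¹)^{ord_w u}`

and hence, for every ring homomorphism `x` out of the ORDINARY Hecke algebra `𝕋^{S,ord}(𝒰)` into a
commutative ring, `∏_{v ∣ p} x(⟨û⟩_v) = ∏_{w} x(T_{w,n}⁻¹)^{ord_w u}`
(`prod_apply_ordDiamond_eq_prod_apply_ordTInv_pow`), for `u ∈ 𝓞 K ∖ 0` a unit above `p` satisfying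
the congruence condition `ι_w(u · 1) ∈ U` at the bad places off `p`. [folklore]
-/

open Literature.NumberTheory.Automorphic Literature.NumberTheory.Automorphic.BigHeckeGLn
open NumberField IsDedekindDomain CategoryTheory

namespace Literature.NumberTheory.Automorphic.BigHeckeGLn

noncomputable section

variable {n : ℕ} {K : Type} [Field K] [NumberField K] {p : ℕ} [Fact p.Prime] (𝒰 : TameLevel n K p)

/-! ### Elements preserving every Hida level under conjugation

The condition `∀ r, ∀ x ∈ U(r), g⁻¹ x g ∈ U(r)` (the hypothesis of `hidaFamily_mul_of_conj`) is closed
under products, powers, and holds for central elements and for elements of `⋂_r U(r)`. -/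

/-- The conjugation condition is closed under products. [folklore] -/
theorem conj_hidaLevel_mul {g g' : FiniteAdelicGL n K}
    (hg : ∀ r, ∀ x ∈ 𝒰.hidaLevel r, g⁻¹ * x * g ∈ 𝒰.hidaLevel r)
    (hg' : ∀ r, ∀ x ∈ 𝒰.hidaLevel r, g'⁻¹ * x * g' ∈ 𝒰.hidaLevel r) :
    ∀ r, ∀ x ∈ 𝒰.hidaLevel r, (g * g')⁻¹ * x * (g * g') ∈ 𝒰.hidaLevel r := fun r x hx => by
  have h := hg' r _ (hg r x hx)
  rwa [show g'⁻¹ * (g⁻¹ * x * g) * g' = (g * g')⁻¹ * x * (g * g') by group] at h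

/-- The conjugation condition is closed under list products. [folklore] -/
theorem conj_hidaLevel_list_prod {l : List (FiniteAdelicGL n K)}
    (h : ∀ g ∈ l, ∀ r, ∀ x ∈ 𝒰.hidaLevel r, g⁻¹ * x * g ∈ 𝒰.hidaLevel r) :
    ∀ r, ∀ x ∈ 𝒰.hidaLevel r, l.prod⁻¹ * x * l.prod ∈ 𝒰.hidaLevel r := by
  induction l with
  | nil => intro r x hx; simpa using hx
  | cons g l ih =>
    rw [List.prod_cons]
    exact conj_hidaLevel_mul 𝒰 (h g List.mem_cons_self) (ih fun g' hg' => h g' (List.mem_cons_of_mem g hg'))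

/-- The conjugation condition is closed under powers. [folklore] -/
theorem conj_hidaLevel_pow {g : FiniteAdelicGL n K}
    (hg : ∀ r, ∀ x ∈ 𝒰.hidaLevel r, g⁻¹ * x * g ∈ 𝒰.hidaLevel r) (e : ℕ) :
    ∀ r, ∀ x ∈ 𝒰.hidaLevel r, (g ^ e)⁻¹ * x * g ^ e ∈ 𝒰.hidaLevel r := by
  induction e with
  | zero => intro r x hx; simpa using hx
  | succ e ih => rw [pow_succ]; exact conj_hidaLevel_mul 𝒰 ih hg

omit [Fact p.Prime] in
/-- Central elements satisfy the conjugation condition (for any family of subgroups). [folklore] -/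
theorem conj_mem_of_mem_center' {g : FiniteAdelicGL n K} (hg : g ∈ Subgroup.center (FiniteAdelicGL n K))
    (L : Subgroup (FiniteAdelicGL n K)) : ∀ x ∈ L, g⁻¹ * x * g ∈ L := fun x hx => by
  rwa [mul_assoc, Subgroup.mem_center_iff.1 hg x, inv_mul_cancel_left]

/-- Elements of every Hida level satisfy the conjugation condition. [folklore] -/
theorem conj_hidaLevel_of_forall_mem {g : FiniteAdelicGL n K} (hg : ∀ r, g ∈ 𝒰.hidaLevel r) :
    ∀ r, ∀ x ∈ 𝒰.hidaLevel r, g⁻¹ * x * g ∈ 𝒰.hidaLevel r :=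
  fun r _ hx => mul_mem (mul_mem (inv_mem (hg r)) hx) (hg r)

omit [Fact p.Prime] 𝒰 in
/-- The central Hecke element `t_{w,n}` is central in `GL_n(𝔸_K^∞)`. [folklore] -/
theorem heckeElement_self_mem_center (w : HeightOneSpectrum (𝓞 K)) :
    heckeElement n K w n ∈ Subgroup.center (FiniteAdelicGL n K) :=
  Subgroup.mem_center_iff.2 fun x => (heckeElement_self_mul_comm w x).symm

/-! ### Multiplicativity of the Hecke families -/

variable (k : Type) [CommRing k]

/-- Hecke families of a list of elements satisfying the conjugation condition multiply. [folklore] -/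
theorem hidaFamily_list_prod {l : List (FiniteAdelicGL n K)}
    (h : ∀ g ∈ l, ∀ r, ∀ x ∈ 𝒰.hidaLevel r, g⁻¹ * x * g ∈ 𝒰.hidaLevel r) :
    𝒰.hidaFamily k l.prod = (l.map (𝒰.hidaFamily k)).prod := by
  induction l with
  | nil => simpa using 𝒰.hidaFamily_one k
  | cons g l ih =>
    rw [List.prod_cons, List.map_cons, List.prod_cons,
      𝒰.hidaFamily_mul_of_conj k (h g List.mem_cons_self)
        (conj_hidaLevel_list_prod 𝒰 fun g' hg' => h g' (List.mem_cons_of_mem g hg')),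
      ih fun g' hg' => h g' (List.mem_cons_of_mem g hg')]

/-- Hecke families of powers of an element satisfying the conjugation condition. [folklore] -/
theorem hidaFamily_pow {g : FiniteAdelicGL n K}
    (hg : ∀ r, ∀ x ∈ 𝒰.hidaLevel r, g⁻¹ * x * g ∈ 𝒰.hidaLevel r) (e : ℕ) :
    𝒰.hidaFamily k (g ^ e) = 𝒰.hidaFamily k g ^ e := by
  induction e with
  | zero => simpa using 𝒰.hidaFamily_one k
  | succ e ih => rw [pow_succ, pow_succ, 𝒰.hidaFamily_mul_of_conj k (conj_hidaLevel_pow 𝒰 hg e) hg, ih]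

/-- **Elements of every Hida level have trivial Hecke family** (`[U(r) y U(r)] = [U(r)] = 1`).
[folklore] -/
theorem hidaFamily_eq_one_of_forall_mem {g : FiniteAdelicGL n K} (hg : ∀ r, g ∈ 𝒰.hidaLevel r) :
    𝒰.hidaFamily k g = 1 := by
  funext x
  rw [TameLevel.hidaFamily_apply, Pi.one_apply]
  have hrep : ArithmeticQuotient.heckeRepHom k (𝒰.hidaLevel x.2.1) g (modPow k (p : k) x.2.2)
      (globalEmbedding n K) = 𝟙 _ := by
    refine Rep.hom_ext (Representation.IntertwiningMap.ext (LinearMap.ext fun f => funext fun c => ?_))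
    induction c using QuotientGroup.induction_on with
    | H y =>
      change ArithmeticQuotient.heckeFun k (𝒰.hidaLevel x.2.1) g (modPow k (p : k) x.2.2) f (y : _ ⧸ _) = f y
      rw [ArithmeticQuotient.heckeFun_apply_mk_of_conj k _ (conj_hidaLevel_of_forall_mem 𝒰 hg x.2.1) f y]
      congr 1
      exact QuotientGroup.eq.2 (by simpa using hg x.2.1)
  unfold ArithmeticQuotient.heckeEnd ArithmeticQuotient.heckeOperator
  rw [hrep, groupCohomology.map_id]
  exact ModuleCat.hom_id

/-- `T_t T_{t⁻¹} = 1` for a central `t`. [folklore] -/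
theorem hidaFamily_mul_hidaFamily_inv_of_mem_center {t : FiniteAdelicGL n K}
    (ht : t ∈ Subgroup.center (FiniteAdelicGL n K)) :
    𝒰.hidaFamily k t * 𝒰.hidaFamily k t⁻¹ = 1 := by
  rw [← 𝒰.hidaFamily_mul_of_conj k (fun r => conj_mem_of_mem_center' ht _)
    (fun r => conj_mem_of_mem_center' (inv_mem ht) _), mul_inv_cancel, 𝒰.hidaFamily_one]

/-- `T_{t⁻¹} T_t = 1` for a central `t`. [folklore] -/
theorem hidaFamily_inv_mul_hidaFamily_of_mem_center {t : FiniteAdelicGL n K}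
    (ht : t ∈ Subgroup.center (FiniteAdelicGL n K)) :
    𝒰.hidaFamily k t⁻¹ * 𝒰.hidaFamily k t = 1 := by
  simpa using hidaFamily_mul_hidaFamily_inv_of_mem_center 𝒰 k (inv_mem ht)

omit [Fact p.Prime] 𝒰 in
/-- In a monoid, `(a₁ ⋯ aₘ)(bₘ ⋯ b₁) = 1` when `aᵢ bᵢ = 1`. [folklore] -/
theorem list_prod_mul_reverse_prod_eq_one {M ι : Type*} [Monoid M] (a b : ι → M) (h : ∀ i, a i * b i = 1) :
    ∀ l : List ι, (l.map a).prod * (l.reverse.map b).prod = 1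
  | [] => by simp
  | i :: l => by
    rw [List.map_cons, List.prod_cons, List.reverse_cons, List.map_append, List.prod_append, List.map_singleton,
      List.prod_singleton, mul_assoc, ← mul_assoc (l.map a).prod, list_prod_mul_reverse_prod_eq_one a b h l,
      one_mul, h]

/-! ### The identity `T_D = T_{C'}` in the product ring and in `𝕋^S(𝒰; p)` -/

variable {𝒰 k}

/-- The local factors of the diamond part satisfy the conjugation condition (`U` maximal above `p`).
[folklore] -/
theorem conj_hidaLevel_of_mem_diamondFactors [DecidableEq (HeightOneSpectrum (𝓞 K))] (h𝒰 : 𝒰.IsMaximalAbove)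
    (û : ∀ v : HeightOneSpectrum (𝓞 K), (p : 𝓞 K) ∈ v.asIdeal → (v.adicCompletionIntegers K)ˣ) :
    ∀ g ∈ (placesAbove K p).toList.map (fun v => ofLocal n K v (diamondLocal (n := n) û v)),
      ∀ r, ∀ x ∈ 𝒰.hidaLevel r, g⁻¹ * x * g ∈ 𝒰.hidaLevel r := by
  intro g hg r x hx
  obtain ⟨v, hv, rfl⟩ := List.mem_map.1 hg
  rw [Finset.mem_toList, mem_placesAbove] at hv
  rw [ofLocal_diamondLocal û hv]
  exact TameLevel.diamondElement_conj_mem_hidaLevel h𝒰 hv _ r hx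

/-- **`T_D · T_C = 1` and `T_D = T_{C⁻¹}`**: for `u ∈ 𝓞 K ∖ 0` a unit above `p` (`û`) with
`ι_w(u·1) ∈ U` at the bad places off `p`, the Hecke family of the diamond part
`D = ∏_{v ∣ p} ⟨(û_v,…,û_v)⟩_v` equals the product over the good `w ∣ u` of `(T_{t_{w,n}⁻¹})^{ord_w u}`
(`U` maximal above `p`). [folklore] -/
theorem hidaFamily_diamondPart_eq (h𝒰 : 𝒰.IsMaximalAbove) {u : 𝓞 K} (hu : u ≠ 0)
    {û : ∀ v : HeightOneSpectrum (𝓞 K), (p : 𝓞 K) ∈ v.asIdeal → (v.adicCompletionIntegers K)ˣ}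
    (hû : ∀ (v : HeightOneSpectrum (𝓞 K)) (hv : (p : 𝓞 K) ∈ v.asIdeal),
      ((û v hv : v.adicCompletionIntegers K) : v.adicCompletion K) = algebraMap K (v.adicCompletion K) (u : K))
    (hbad : ∀ w ∈ 𝒰.bad, (p : 𝓞 K) ∉ w.asIdeal → ofLocal n K w (localScalar w (unitOf u hu)) ∈ 𝒰.subgroup) :
    𝒰.hidaFamily k (diamondPart û) =
      ((goodSupport 𝒰 u hu).toList.reverse.map fun w =>
        𝒰.hidaFamily k (heckeElement n K w n)⁻¹ ^ ordAt w u).prod := by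
  classical
  -- conjugation conditions
  have hDl := conj_hidaLevel_of_mem_diamondFactors (n := n) h𝒰 û
  have hD : ∀ r, ∀ x ∈ 𝒰.hidaLevel r, (diamondPart (n := n) û)⁻¹ * x * diamondPart û ∈ 𝒰.hidaLevel r :=
    conj_hidaLevel_list_prod 𝒰 hDl
  have hCl : ∀ g ∈ (goodSupport 𝒰 u hu).toList.map (fun w => ofLocal n K w (centralLocal (n := n) u w)),
      ∀ r, ∀ x ∈ 𝒰.hidaLevel r, g⁻¹ * x * g ∈ 𝒰.hidaLevel r := by
    intro g hg r
    obtain ⟨w, -, rfl⟩ := List.mem_map.1 hg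
    rw [ofLocal_centralLocal]
    exact conj_mem_of_mem_center' (pow_mem (heckeElement_self_mem_center w) _) _
  have hC : ∀ r, ∀ x ∈ 𝒰.hidaLevel r, (centralPart 𝒰 u hu)⁻¹ * x * centralPart 𝒰 u hu ∈ 𝒰.hidaLevel r :=
    conj_hidaLevel_list_prod 𝒰 hCl
  have hy : ∀ r, scalarRemainder 𝒰 u hu û ∈ 𝒰.hidaLevel r := scalarRemainder_mem_hidaLevel 𝒰 hu hû hbad
  -- `1 = T_z = T_D T_C T_y = T_D T_C`
  have h1 : 𝒰.hidaFamily k (diamondPart û) * 𝒰.hidaFamily k (centralPart 𝒰 u hu) = 1 := by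
    have hz := hidaFamily_globalEmbedding_scalar 𝒰 k (unitOf u hu)
    rwa [globalEmbedding_scalar_eq 𝒰 u hu û, 𝒰.hidaFamily_mul_of_conj k (conj_hidaLevel_mul 𝒰 hD hC)
      (conj_hidaLevel_of_forall_mem 𝒰 hy), 𝒰.hidaFamily_mul_of_conj k hD hC,
      hidaFamily_eq_one_of_forall_mem 𝒰 k hy, mul_one] at hz
  -- `T_C T_{C'} = 1`
  have h2 : 𝒰.hidaFamily k (centralPart 𝒰 u hu) *
      ((goodSupport 𝒰 u hu).toList.reverse.map fun w => 𝒰.hidaFamily k (heckeElement n K w n)⁻¹ ^ ordAt w u).prod = 1 := by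
    rw [centralPart, hidaFamily_list_prod 𝒰 k hCl, List.map_map]
    refine list_prod_mul_reverse_prod_eq_one (fun w => 𝒰.hidaFamily k (ofLocal n K w (centralLocal u w)))
      (fun w => 𝒰.hidaFamily k (heckeElement n K w n)⁻¹ ^ ordAt w u) (fun w => ?_) _
    have hmul := hidaFamily_mul_hidaFamily_inv_of_mem_center 𝒰 k (heckeElement_self_mem_center (n := n) w)
    have hmul' := hidaFamily_inv_mul_hidaFamily_of_mem_center 𝒰 k (heckeElement_self_mem_center (n := n) w)
    have hcomm : Commute (𝒰.hidaFamily k (heckeElement n K w n)) (𝒰.hidaFamily k (heckeElement n K w n)⁻¹) := by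
      rw [Commute, SemiconjBy, hmul, hmul']
    change 𝒰.hidaFamily k (ofLocal n K w (centralLocal u w)) * _ = 1
    rw [ofLocal_centralLocal, hidaFamily_pow 𝒰 k (fun r => conj_mem_of_mem_center' (heckeElement_self_mem_center w) _),
      ← hcomm.mul_pow, hmul, one_pow]
  calc 𝒰.hidaFamily k (diamondPart û)
      = 𝒰.hidaFamily k (diamondPart û) * (𝒰.hidaFamily k (centralPart 𝒰 u hu) *
          ((goodSupport 𝒰 u hu).toList.reverse.map fun w =>
            𝒰.hidaFamily k (heckeElement n K w n)⁻¹ ^ ordAt w u).prod) := by rw [h2, mul_one]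
    _ = _ := by rw [← mul_assoc, h1, one_mul]

open scoped Classical in
/-- The diamond operator `⟨(û_v, …, û_v)⟩_v ∈ 𝕋^S(𝒰; p)` at a place `v` (and `1` off `p`). [folklore] -/
def hidaDiamondAt (𝒰 : TameLevel n K p)
    (û : ∀ v : HeightOneSpectrum (𝓞 K), (p : 𝓞 K) ∈ v.asIdeal → (v.adicCompletionIntegers K)ˣ)
    (v : HeightOneSpectrum (𝓞 K)) : HidaHeckeAlgebraGLn 𝒰 :=
  if hv : (p : 𝓞 K) ∈ v.asIdeal then 𝒰.hidaDiamond hv (fun _ : Fin n => û v hv) else 1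

/-- The family underlying `hidaDiamondAt`. [folklore] -/
theorem coe_hidaDiamondAt (û : ∀ v : HeightOneSpectrum (𝓞 K), (p : 𝓞 K) ∈ v.asIdeal → (v.adicCompletionIntegers K)ˣ)
    (v : HeightOneSpectrum (𝓞 K)) :
    (hidaDiamondAt 𝒰 û v : 𝒰.hidaEndProd ℤ) = 𝒰.hidaFamily ℤ (ofLocal n K v (diamondLocal û v)) := by
  unfold hidaDiamondAt diamondLocal
  split_ifs with hv
  · rfl
  · rw [map_one, 𝒰.hidaFamily_one]; rfl

/-- The family underlying `hidaTInv w` at a good place. [folklore] -/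
theorem coe_hidaTInv {w : HeightOneSpectrum (𝓞 K)} (hw : w ∉ 𝒰.bad) :
    (𝒰.hidaTInv w : 𝒰.hidaEndProd ℤ) = 𝒰.hidaFamily ℤ (heckeElement n K w n)⁻¹ := by
  classical
  have hw' : 𝒰.IsHidaPlace w := Or.inl hw
  rw [TameLevel.hidaTInv, dif_pos hw']
  rfl

/-- **The identity `∏_{v ∣ p} ⟨û⟩_v = ∏_{w} (T_{w,n}⁻¹)^{ord_w u}` in `𝕋^S(𝒰; p)`** (list form).
[folklore] -/
theorem prod_hidaDiamondAt_eq (h𝒰 : 𝒰.IsMaximalAbove) {u : 𝓞 K} (hu : u ≠ 0)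
    {û : ∀ v : HeightOneSpectrum (𝓞 K), (p : 𝓞 K) ∈ v.asIdeal → (v.adicCompletionIntegers K)ˣ}
    (hû : ∀ (v : HeightOneSpectrum (𝓞 K)) (hv : (p : 𝓞 K) ∈ v.asIdeal),
      ((û v hv : v.adicCompletionIntegers K) : v.adicCompletion K) = algebraMap K (v.adicCompletion K) (u : K))
    (hbad : ∀ w ∈ 𝒰.bad, (p : 𝓞 K) ∉ w.asIdeal → ofLocal n K w (localScalar w (unitOf u hu)) ∈ 𝒰.subgroup) :
    ((placesAbove K p).toList.map (hidaDiamondAt 𝒰 û)).prod =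
      ((goodSupport 𝒰 u hu).toList.reverse.map fun w => 𝒰.hidaTInv w ^ ordAt w u).prod := by
  classical
  apply Subtype.ext
  rw [SubmonoidClass.coe_list_prod, SubmonoidClass.coe_list_prod, List.map_map, List.map_map]
  have hL : (placesAbove K p).toList.map (Subtype.val ∘ hidaDiamondAt 𝒰 û) =
      ((placesAbove K p).toList.map fun v => ofLocal n K v (diamondLocal (n := n) û v)).map (𝒰.hidaFamily ℤ) := by
    rw [List.map_map]
    exact List.map_congr_left fun v _ => coe_hidaDiamondAt û v
  have hR : (goodSupport 𝒰 u hu).toList.reverse.map (Subtype.val ∘ fun w => 𝒰.hidaTInv w ^ ordAt w u) =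
      (goodSupport 𝒰 u hu).toList.reverse.map fun w => 𝒰.hidaFamily ℤ (heckeElement n K w n)⁻¹ ^ ordAt w u := by
    refine List.map_congr_left fun w hw => ?_
    rw [List.mem_reverse, Finset.mem_toList, mem_goodSupport] at hw
    rw [Function.comp_apply, SubmonoidClass.coe_pow, coe_hidaTInv hw.2]
  rw [hL, hR, ← hidaFamily_list_prod 𝒰 ℤ (conj_hidaLevel_of_mem_diamondFactors h𝒰 û)]
  exact hidaFamily_diamondPart_eq h𝒰 hu hû hbad

/-- The identity under a ring homomorphism `φ : 𝕋^S(𝒰; p) → A` into a commutative ring: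
`∏_{v ∣ p} φ(⟨û⟩_v) = ∏_w φ(T_{w,n}⁻¹)^{ord_w u}`. [folklore] -/
theorem prod_apply_hidaDiamondAt_eq {A : Type*} [CommRing A] (φ : HidaHeckeAlgebraGLn 𝒰 →+* A)
    (h𝒰 : 𝒰.IsMaximalAbove) {u : 𝓞 K} (hu : u ≠ 0)
    {û : ∀ v : HeightOneSpectrum (𝓞 K), (p : 𝓞 K) ∈ v.asIdeal → (v.adicCompletionIntegers K)ˣ}
    (hû : ∀ (v : HeightOneSpectrum (𝓞 K)) (hv : (p : 𝓞 K) ∈ v.asIdeal),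
      ((û v hv : v.adicCompletionIntegers K) : v.adicCompletion K) = algebraMap K (v.adicCompletion K) (u : K))
    (hbad : ∀ w ∈ 𝒰.bad, (p : 𝓞 K) ∉ w.asIdeal → ofLocal n K w (localScalar w (unitOf u hu)) ∈ 𝒰.subgroup) :
    ∏ v ∈ placesAbove K p, φ (hidaDiamondAt 𝒰 û v) =
      ∏ w ∈ goodSupport 𝒰 u hu, φ (𝒰.hidaTInv w) ^ ordAt w u := by
  have h := congrArg φ (prod_hidaDiamondAt_eq h𝒰 hu hû hbad)
  rw [map_list_prod, map_list_prod, List.map_map, List.map_map, List.map_reverse, List.prod_reverse,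
    Finset.prod_map_toList, Finset.prod_map_toList] at h
  simpa only [Function.comp_def, map_pow] using h

open scoped Classical in
/-- The diamond operator `⟨(û_v, …, û_v)⟩_v` in the ORDINARY Hecke algebra `𝕋^{S,ord}(𝒰)` at a place
`v` (and `1` off `p`). [folklore] -/
def ordDiamondAt (𝒰 : TameLevel n K p)
    (û : ∀ v : HeightOneSpectrum (𝓞 K), (p : 𝓞 K) ∈ v.asIdeal → (v.adicCompletionIntegers K)ˣ)
    (v : HeightOneSpectrum (𝓞 K)) : OrdinaryHeckeAlgebraGLn 𝒰 :=
  if hv : (p : 𝓞 K) ∈ v.asIdeal then 𝒰.ordDiamond hv (fun _ : Fin n => û v hv) else 1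

/-- `toOrd ⟨û⟩_v = ⟨û⟩_v`. [folklore] -/
theorem toOrd_hidaDiamondAt (û : ∀ v : HeightOneSpectrum (𝓞 K), (p : 𝓞 K) ∈ v.asIdeal → (v.adicCompletionIntegers K)ˣ)
    (v : HeightOneSpectrum (𝓞 K)) : 𝒰.toOrd ℤ (hidaDiamondAt 𝒰 û v) = ordDiamondAt 𝒰 û v := by
  unfold hidaDiamondAt ordDiamondAt
  split_ifs
  · rfl
  · exact map_one _

/-- Above `p`, `ordDiamondAt` is the diamond operator `ordDiamond`. [folklore] -/
theorem ordDiamondAt_of_mem (û : ∀ v : HeightOneSpectrum (𝓞 K), (p : 𝓞 K) ∈ v.asIdeal → (v.adicCompletionIntegers K)ˣ)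
    {v : HeightOneSpectrum (𝓞 K)} (hv : (p : 𝓞 K) ∈ v.asIdeal) :
    ordDiamondAt 𝒰 û v = 𝒰.ordDiamond hv (fun _ : Fin n => û v hv) := by
  unfold ordDiamondAt
  rw [dif_pos hv]

/-- **The centre of the diamond character in terms of the `T_{w,n}⁻¹`.** For `U` maximal above
`p`, any ring homomorphism `x : 𝕋^{S,ord}(𝒰) → A` into a commutative ring, and `u ∈ 𝓞 K ∖ 0` a unit
above `p` (`û_v = u`) with `ι_w(u · 1) ∈ U` at the bad places off `p`:
`∏_{v ∣ p} x(⟨(û_v, …, û_v)⟩_v) = ∏_{w ∣ u, w ∉ S} x(T_{w,n}⁻¹)^{ord_w u}`. [folklore] -/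
theorem prod_apply_ordDiamondAt_eq {A : Type*} [CommRing A] (x : OrdinaryHeckeAlgebraGLn 𝒰 →+* A)
    (h𝒰 : 𝒰.IsMaximalAbove) {u : 𝓞 K} (hu : u ≠ 0)
    {û : ∀ v : HeightOneSpectrum (𝓞 K), (p : 𝓞 K) ∈ v.asIdeal → (v.adicCompletionIntegers K)ˣ}
    (hû : ∀ (v : HeightOneSpectrum (𝓞 K)) (hv : (p : 𝓞 K) ∈ v.asIdeal),
      ((û v hv : v.adicCompletionIntegers K) : v.adicCompletion K) = algebraMap K (v.adicCompletion K) (u : K))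
    (hbad : ∀ w ∈ 𝒰.bad, (p : 𝓞 K) ∉ w.asIdeal → ofLocal n K w (localScalar w (unitOf u hu)) ∈ 𝒰.subgroup) :
    ∏ v ∈ placesAbove K p, x (ordDiamondAt 𝒰 û v) =
      ∏ w ∈ goodSupport 𝒰 u hu, x (𝒰.ordTInv w) ^ ordAt w u := by
  have h := prod_apply_hidaDiamondAt_eq (x.comp (𝒰.toOrd ℤ)) h𝒰 hu hû hbad
  simpa only [RingHom.comp_apply, toOrd_hidaDiamondAt, TameLevel.toOrd_hidaTInv] using h

end

end Literature.NumberTheory.Automorphic.BigHeckeGLn
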